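import Mathlib
import HarnessLib

/-!
# `NoHeavyLowerTail` (stmt-CriticalPhenomena-4575) — the 6-to-1 fibre count of Step 2 (MWF-CERT §5), abstract form

Support file (prover `prim-gen-swap` gen 9; `--supports stmt-CriticalPhenomena-4575`).  No definitions, no named facts, no sorries; Mathlib only.

Step 2 of the U0' supply proof charges each (pair, star `i`, star `j`, third star `n`, word index `b`) to a hair word `w_b(i,j,n)` with three
designated stars; a word receives at most `6` charges because `(word; i, j)` determines the charge and `(i, j)` is an ordered pair of distinct
designated stars of the word.  The abstract statement:

* `StarSet.sum_le_six_mul_of_fibres` — for a finite set `X` of charges, a word map `φ : X → (Fin m → Fin 3)` into `E3` with at most three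
  designated stars per word, and labels `π x = (i, j)` (distinct, designated) such that `(φ, π)` is injective on `X`:
  `Σ_{x∈X} g(φ x) ≤ 6 · Σ_{e∈E3} g e` for every `g ≥ 0`.
-/

namespace Summit.CriticalPhenomena.PercolationContinuityZ3.Theorems

open Finset
open scoped BigOperators

namespace StarSet

variable {m : ℕ}

/-- **Six-to-one fibre count.**  See the file header. [MWF-CERT.md §5 Step 2] -/
theorem sum_le_six_mul_of_fibres {α : Type*} [DecidableEq α] (X : Finset α) (φ : α → (Fin m → Fin 3)) (π : α → Fin m × Fin m)
    (g : (Fin m → Fin 3) → ℝ) (hg : ∀ e, 0 ≤ g e) (E3 : Finset (Fin m → Fin 3)) (hE : ∀ x ∈ X, φ x ∈ E3)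
    (hinj : ∀ x ∈ X, ∀ y ∈ X, φ x = φ y → π x = π y → x = y)
    (hπ : ∀ x ∈ X, (π x).1 ≠ (π x).2 ∧ φ x (π x).1 ≠ 0 ∧ φ x (π x).2 ≠ 0)
    (hD : ∀ x ∈ X, (univ.filter fun y => φ x y ≠ 0).card ≤ 3) :
    ∑ x ∈ X, g (φ x) ≤ 6 * ∑ e ∈ E3, g e := by
  rw [← sum_fiberwise_of_maps_to hE]
  rw [mul_sum]
  refine sum_le_sum fun e he => ?_
  -- the fibre of `e`
  set Fe := X.filter (fun x => φ x = e) with hFe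
  have hconst : ∑ x ∈ Fe, g (φ x) = (Fe.card : ℝ) * g e := by
    rw [sum_congr rfl fun x hx => by rw [(mem_filter.1 hx).2], sum_const, nsmul_eq_mul]
  rw [hconst]
  refine mul_le_mul_of_nonneg_right ?_ (hg e)
  -- `#Fe ≤ 6`
  by_cases hne : Fe.Nonempty
  · obtain ⟨x₀, hx₀⟩ := hne
    have hx₀X : x₀ ∈ X := (mem_filter.1 hx₀).1
    have hx₀e : φ x₀ = e := (mem_filter.1 hx₀).2
    set D := univ.filter (fun y => e y ≠ 0) with hDdef
    have hDcard : D.card ≤ 3 := by rw [hDdef, ← hx₀e]; exact hD x₀ hx₀X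
    have hinjOn : Set.InjOn π ↑Fe := by
      intro x hx y hy hxy
      have hx' := mem_filter.1 (mem_coe.1 hx); have hy' := mem_filter.1 (mem_coe.1 hy)
      exact hinj x hx'.1 y hy'.1 (hx'.2.trans hy'.2.symm) hxy
    have hsub : Fe.image π ⊆ D.offDiag := by
      intro z hz
      obtain ⟨x, hx, rfl⟩ := mem_image.1 hz
      have hx' := mem_filter.1 hx
      obtain ⟨h1, h2, h3⟩ := hπ x hx'.1
      rw [hx'.2] at h2 h3
      exact mem_offDiag.2 ⟨mem_filter.2 ⟨mem_univ _, h2⟩, mem_filter.2 ⟨mem_univ _, h3⟩, h1⟩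
    have hcard : Fe.card ≤ 6 := by
      calc Fe.card = (Fe.image π).card := (card_image_of_injOn hinjOn).symm
        _ ≤ D.offDiag.card := card_le_card hsub
        _ = D.card * D.card - D.card := offDiag_card D
        _ ≤ 6 := by
            have h := hDcard
            interval_cases hc : D.card <;> omega
    exact_mod_cast hcard
  · rw [not_nonempty_iff_eq_empty.1 hne, card_empty]; norm_num

end StarSet

end Summit.CriticalPhenomena.PercolationContinuityZ3.Theorems
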